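import Summits.QuantumFields.QCD.Theorems.QuarksAsStableActionStableActionBridgeDefs
import Literature.MathematicalPhysics.QuantumFieldTheory.QCDSiteReflectionPositivityProofs
import Literature.MathematicalPhysics.QuantumFieldTheory.QCDTimeReflectionProofs
import Literature.MathematicalPhysics.QuantumLattice.GrassmannIntegralPartial
import HarnessLib

/-!
# Locality and Grassmann support of the lattice QCD insertions (forward and reflected-backward)

Stub `stub_insertion_local` of the line `Sketch` (reshape r3e: thermal re-basing) for the crux
`QuarksAsStableAction.StableActionBridge` (stmt-QuantumFields-9737).  The site-reflection positivity proof of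
the tree (`QCDSiteReflectionPositivityProofs`) needs, of an observable placed on the torus of side `L = 2S+1`,
exactly two things: dependence on the POSITIVE links `posLinks S` only (temporal links based at times
`0 … S−1`, spatial links at times `1 … S`), and Grassmann content off the negative-time generators `negGens`
(`t > L/2 = S`) and the slice generators `zeroGens` (`t = 0`), i.e. membership in
`spectatorSubalgebra ℂ (negGens ∪ zeroGens)`.  This file supplies both facts for the single insertions
`insertion U s y` of `QCDOS` and for their reflected-backward versions `insertion U.negReflect s (θ₀ y)`
(`θ₀ = siteReflect`), together with the `Θ_T`-image (`torusTheta`) of the latter: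

* `s = glue`: the insertion is the SCALAR `algebraMap` of the Wilson action density of the six forward
  plaquettes based at `y`; it reads the links of `U` at `proj y`, `proj (y + ê_μ)`, i.e. temporal links at time
  `y₀` and spatial links at times `y₀, y₀ + 1` — positive as soon as `1 ≤ y₀`, `y₀ + 1 ≤ S`
  (`insertion_glue_congr`).  In the reflected field `U.negReflect` read at `θ₀ y` the same plaquettes read the
  links of `U` at times `y₀ − 1` (temporal) and `y₀ − 1, y₀` (spatial) (`negReflect_proj_zero`,
  `negReflect_proj_of_ne`), positive as soon as `2 ≤ y₀ ≤ S` (`insertion_glue_negReflect_congr`).  Scalars lie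
  in every subalgebra and `Θ_T` maps scalars to scalars (`torusTheta_algebraMap`).
* mesons: `insertion U (pseudoRe/pseudoIm f g) y` are `ℂ`-combinations of the bilinears `P_{fg}(proj y)`,
  sums of `ψ̄_{f,proj y,a,α} ψ_{g,proj y,a,β}` — no gauge field at all (locality is `rfl`), generators at torus
  time `y₀ ∈ [1, S] = [1, L/2]` (`gen_mem_spectator_of_time`); and `Θ_T` maps a generator at `proj (θ₀ y)`
  to a `γ₀`-combination of generators at `Site.negReflect (proj (θ₀ y)) = proj y` (`torusTheta_q`,
  `torusTheta_qbar`, `proj_siteReflect`), again at time `y₀`.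

Everything is proved; no named fact.  References: Montvay–Münster 1994 §4.2.3 (4.90), (4.99)–(4.100);
Osterwalder–Seiler 1978 §2.
-/

noncomputable section

open scoped SchwartzMap BigOperators ComplexConjugate
open MeasureTheory Filter Topology
open Literature.MathematicalPhysics.QuantumFieldTheory Literature.MathematicalPhysics.QuantumLattice
open Literature.MathematicalPhysics.QuantumLattice.GrassmannAlgebra
open Literature.MathematicalPhysics.AQFT
open Literature.Probability.LatticeModels (box Site)
open Literature.Probability.LatticeModels (TorusSite Torus.proj Torus.proj_apply)

namespace Summit.QuantumFields.QCD.Cruxes.StableActionBridge.Sketch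

local notation "𝔾" => Matrix.specialUnitaryGroup (Fin 3) ℂ

/-! ### Torus times of integer sites and the positive links -/

section Links

variable {S : ℕ}

/-- For `0 ≤ x₀ < L` the torus time of `proj x` is `x₀`. -/
theorem natCast_val_proj_zero {L : ℕ} [NeZero L] (x : Site 4) (h0 : 0 ≤ x 0) (hL : x 0 < L) :
    (((Torus.proj L x) 0).val : ℤ) = x 0 := by
  rw [Torus.proj_apply, ZMod.val_intCast, Int.emod_eq_of_lt h0 hL]

/-- The time coordinate of `ê_i + y`. -/
theorem single_add_apply_zero (i : Fin 4) (y : Site 4) :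
    (Pi.single i (1 : ℤ) + y : Site 4) 0 = (if i = 0 then 1 else 0) + y 0 := by
  by_cases hi : i = 0
  · subst hi; simp
  · simp [hi]

/-- A temporal torus link based at the integer site `x` with `0 ≤ x₀`, `x₀ + 1 ≤ S` is a positive link of
the torus of side `2S+1`. -/
theorem proj_zero_mem_posLinks (x : Site 4) (h0 : 0 ≤ x 0) (h1 : x 0 + 1 ≤ S) :
    ((Torus.proj (2 * S + 1) x, (0 : Fin 4)) : Edge 4 (2 * S + 1)) ∈ posLinks S := by
  rw [mem_posLinks]
  have hv := natCast_val_proj_zero (L := 2 * S + 1) x h0 (by push_cast; omega)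
  exact Or.inl ⟨rfl, by simp only; omega⟩

/-- A spatial torus link based at the integer site `x` with `1 ≤ x₀ ≤ S` is a positive link of the torus of
side `2S+1`. -/
theorem proj_ne_mem_posLinks (x : Site 4) {μ : Fin 4} (hμ : μ ≠ 0) (h1 : 1 ≤ x 0) (h2 : x 0 ≤ S) :
    ((Torus.proj (2 * S + 1) x, μ) : Edge 4 (2 * S + 1)) ∈ posLinks S := by
  rw [mem_posLinks]
  have hv := natCast_val_proj_zero (L := 2 * S + 1) x (by omega) (by push_cast; omega)
  exact Or.inr ⟨hμ, by simp only; omega, by simp only; omega⟩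

/-- Two gauge fields agreeing on the positive links agree on every torus link based at an integer site `x`
with `1 ≤ x₀` and `x₀ + 1 ≤ S`, and on the temporal one already for `0 ≤ x₀`, on the spatial ones already for
`x₀ ≤ S`. -/
theorem apply_proj_congr {U U' : GaugeConfig 4 (2 * S + 1) 𝔾} (h : ∀ e ∈ posLinks S, U e = U' e)
    (x : Site 4) (μ : Fin 4) (h0 : 0 ≤ x 0) (h1 : μ ≠ 0 → 1 ≤ x 0) (h2 : x 0 ≤ S)
    (h3 : μ = 0 → x 0 + 1 ≤ S) :
    U (Torus.proj (2 * S + 1) x, μ) = U' (Torus.proj (2 * S + 1) x, μ) := by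
  by_cases hμ : μ = 0
  · subst hμ
    exact h _ (proj_zero_mem_posLinks x h0 (h3 rfl))
  · exact h _ (proj_ne_mem_posLinks x hμ (h1 hμ) h2)

/-- `proj` intertwines the forward time step. -/
theorem shift_proj_zero {L : ℕ} (w : Site 4) :
    Literature.MathematicalPhysics.QuantumFieldTheory.Site.shift (Torus.proj L w) 0 =
      Torus.proj L (w + Pi.single 0 1) := by
  funext k
  simp only [Literature.MathematicalPhysics.QuantumFieldTheory.Site.shift, Pi.add_apply, Torus.proj_apply,
    Int.cast_add]
  by_cases hk : k = 0
  · subst hk; simp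
  · simp [Pi.single_eq_of_ne hk]

/-- **The site-reflected gauge field on a temporal link at an integer site**:
`U^{θ}(proj w, 0) = U(proj (θ₀ w − ê₀), 0)⁻¹`. -/
theorem negReflect_proj_zero {L : ℕ} (U : GaugeConfig 4 L 𝔾) (w : Site 4) :
    U.negReflect (Torus.proj L w, 0) = (U (Torus.proj L (siteReflect w - Pi.single 0 1), 0))⁻¹ := by
  rw [GaugeConfig.negReflect_apply_zero, shift_proj_zero, ← proj_siteReflect, siteReflect_add_single_zero]

/-- **The site-reflected gauge field on a spatial link at an integer site**: `U^{θ}(proj w, μ) = U(proj (θ₀ w), μ)`. -/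
theorem negReflect_proj_of_ne {L : ℕ} (U : GaugeConfig 4 L 𝔾) (w : Site 4) {μ : Fin 4} (hμ : μ ≠ 0) :
    U.negReflect (Torus.proj L w, μ) = U (Torus.proj L (siteReflect w), μ) := by
  rw [GaugeConfig.negReflect_apply_of_ne _ _ hμ, ← proj_siteReflect]

/-- Two gauge fields agreeing on the positive links have site-reflected fields agreeing on every torus link
based at an integer site `w` with `1 ≤ −w₀ ≤ S`. -/
theorem negReflect_proj_congr {U U' : GaugeConfig 4 (2 * S + 1) 𝔾} (h : ∀ e ∈ posLinks S, U e = U' e)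
    (w : Site 4) (h1 : 1 ≤ -w 0) (h2 : -w 0 ≤ S) (μ : Fin 4) :
    U.negReflect (Torus.proj (2 * S + 1) w, μ) = U'.negReflect (Torus.proj (2 * S + 1) w, μ) := by
  by_cases hμ : μ = 0
  · subst hμ
    have ht : (siteReflect w - Pi.single 0 1 : Site 4) 0 = -w 0 - 1 := by simp
    rw [negReflect_proj_zero, negReflect_proj_zero,
      h _ (proj_zero_mem_posLinks _ (by rw [ht]; omega) (by rw [ht]; omega))]
  · have ht : (siteReflect w) 0 = -w 0 := siteReflect_apply_zero w
    rw [negReflect_proj_of_ne _ _ hμ, negReflect_proj_of_ne _ _ hμ,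
      h _ (proj_ne_mem_posLinks _ hμ (by rw [ht]; exact h1) (by rw [ht]; exact h2))]

end Links

/-! ### The action density reads the plaquettes at the origin -/

section Density

/-- The Wilson action density at the origin depends only on the links of the six forward plaquettes based at
the origin. -/
theorem actionDensity_congr {G : Type} [Group G] {N : ℕ} (ρ : G →* Matrix (Fin N) (Fin N) ℂ)
    {V V' : LGConfig 4 G}
    (h : ∀ i j : Fin 4, i < j →
      V (0, i) = V' (0, i) ∧ V (Pi.single i 1, j) = V' (Pi.single i 1, j) ∧
        V (Pi.single j 1, i) = V' (Pi.single j 1, i) ∧ V (0, j) = V' (0, j)) :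
    actionDensity ρ V = actionDensity ρ V' := by
  unfold actionDensity
  refine Finset.sum_congr rfl fun i _ => Finset.sum_congr rfl fun j _ => ?_
  by_cases hij : i < j
  · obtain ⟨h1, h2, h3, h4⟩ := h i j hij
    simp only [if_pos hij, plaquetteObs, plaquetteHolonomyZd, zero_add, h1, h2, h3, h4]
  · rw [if_neg hij, if_neg hij]

variable {Nf S : ℕ}

/-- **The forward glue insertion at `y` with `1 ≤ y₀`, `y₀ + 1 ≤ S` depends on the positive links only.** -/
theorem insertion_glue_congr {y : Site 4} (hy1 : 1 ≤ y 0) (hyS : y 0 + 1 ≤ S)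
    {U U' : GaugeConfig 4 (2 * S + 1) 𝔾} (h : ∀ e ∈ posLinks S, U e = U' e) :
    insertion U (QCDField.glue : QCDField Nf) y = insertion U' QCDField.glue y := by
  have key : actionDensity (fundamentalRep (Fin 3)) (configShift (-y) (torusLift (2 * S + 1) U)) =
      actionDensity (fundamentalRep (Fin 3)) (configShift (-y) (torusLift (2 * S + 1) U')) := by
    refine actionDensity_congr _ fun i j hij => ?_
    have hj : j ≠ 0 := ne_of_gt (lt_of_le_of_lt (Fin.zero_le i) hij)
    simp only [configShift_apply, torusLift, Function.comp_apply, torusEdge, sub_neg_eq_add, zero_add]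
    have hti := single_add_apply_zero i y
    have htj := single_add_apply_zero j y
    rw [if_neg hj] at htj
    refine ⟨apply_proj_congr h y i (by omega) (fun _ => hy1) (by omega) (fun _ => hyS),
      apply_proj_congr h _ j ?_ ?_ ?_ (fun hj' => absurd hj' hj),
      apply_proj_congr h _ i (by omega) (fun _ => by omega) (by omega) (fun _ => by omega),
      apply_proj_congr h y j (by omega) (fun _ => hy1) (by omega) (fun hj' => absurd hj' hj)⟩
    · rw [hti]; split_ifs <;> omega
    · intro; rw [hti]; split_ifs <;> omega
    · rw [hti]; split_ifs <;> omega
  simp only [insertion, key]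

/-- **The reflected-backward glue insertion at `θ₀ y` with `2 ≤ y₀ ≤ S` depends on the positive links only**
(it reads the links of `U` at times `y₀ − 1`, `y₀`). -/
theorem insertion_glue_negReflect_congr {y : Site 4} (hy2 : 2 ≤ y 0) (hyS : y 0 ≤ S)
    {U U' : GaugeConfig 4 (2 * S + 1) 𝔾} (h : ∀ e ∈ posLinks S, U e = U' e) :
    insertion U.negReflect (QCDField.glue : QCDField Nf) (siteReflect y) =
      insertion U'.negReflect QCDField.glue (siteReflect y) := by
  have key : actionDensity (fundamentalRep (Fin 3))
        (configShift (-siteReflect y) (torusLift (2 * S + 1) U.negReflect)) =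
      actionDensity (fundamentalRep (Fin 3))
        (configShift (-siteReflect y) (torusLift (2 * S + 1) U'.negReflect)) := by
    refine actionDensity_congr _ fun i j hij => ?_
    have hj : j ≠ 0 := ne_of_gt (lt_of_le_of_lt (Fin.zero_le i) hij)
    simp only [configShift_apply, torusLift, Function.comp_apply, torusEdge, sub_neg_eq_add, zero_add]
    have ht0 : (siteReflect y) 0 = -y 0 := siteReflect_apply_zero y
    have hti := single_add_apply_zero i (siteReflect y)
    have htj := single_add_apply_zero j (siteReflect y)
    rw [if_neg hj, ht0] at htj
    rw [ht0] at hti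
    refine ⟨negReflect_proj_congr h _ (by omega) (by omega) i, negReflect_proj_congr h _ ?_ ?_ j,
      negReflect_proj_congr h _ (by omega) (by omega) i, negReflect_proj_congr h _ (by omega) (by omega) j⟩
    · rw [hti]; split_ifs <;> omega
    · rw [hti]; split_ifs <;> omega
  simp only [insertion, key]

end Density

/-! ### Grassmann support of the meson insertions -/

section Mesons

variable {Nf S : ℕ}

/-- A quark generator `ψ̄` at a torus site of time `1 ≤ t ≤ S` is a spectator of `N ∪ Z` (`L = 2S+1`). -/
theorem qbar_mem_spectator (f : Fin Nf) (x : TorusSite 4 (2 * S + 1)) (a : Fin 3) (α : Fin 4)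
    (h1 : 1 ≤ (x 0).val) (h2 : (x 0).val ≤ S) :
    qbar (f, (x, a, α)) ∈ spectatorSubalgebra ℂ (negGens Nf (2 * S + 1) ∪ zeroGens Nf (2 * S + 1)) := by
  refine gen_mem_spectator_of_time ?_
  simp only [genTimeT, genIdx_inl, idxTime_quarkEquiv]
  omega

/-- A quark generator `ψ` at a torus site of time `1 ≤ t ≤ S` is a spectator of `N ∪ Z` (`L = 2S+1`). -/
theorem q_mem_spectator (f : Fin Nf) (x : TorusSite 4 (2 * S + 1)) (a : Fin 3) (α : Fin 4)
    (h1 : 1 ≤ (x 0).val) (h2 : (x 0).val ≤ S) :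
    q (f, (x, a, α)) ∈ spectatorSubalgebra ℂ (negGens Nf (2 * S + 1) ∪ zeroGens Nf (2 * S + 1)) := by
  refine gen_mem_spectator_of_time ?_
  simp only [genTimeT, genIdx_inr, idxTime_quarkEquiv]
  omega

/-- **The pseudoscalar bilinear at a torus site of time `1 ≤ t ≤ S` is a spectator of `N ∪ Z`.** -/
theorem pseudoscalarBilinear_mem_spectator (f g : Fin Nf) (x : TorusSite 4 (2 * S + 1))
    (h1 : 1 ≤ (x 0).val) (h2 : (x 0).val ≤ S) :
    pseudoscalarBilinear f g x ∈
      spectatorSubalgebra ℂ (negGens Nf (2 * S + 1) ∪ zeroGens Nf (2 * S + 1)) := by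
  unfold pseudoscalarBilinear
  exact Subalgebra.sum_mem _ fun a _ => Subalgebra.sum_mem _ fun α _ => Subalgebra.sum_mem _ fun β _ =>
    Subalgebra.smul_mem _ (Subalgebra.mul_mem _ (qbar_mem_spectator f x a α h1 h2)
      (q_mem_spectator g x a β h1 h2)) _

/-- **The `Θ_T`-image of the pseudoscalar bilinear at a torus site `x` whose REFLECTION has time
`1 ≤ t ≤ S` is a spectator of `N ∪ Z`** (`Θ_T` maps generators at `x` to `γ₀`-combinations of generators at
`Site.negReflect x`). -/
theorem torusTheta_pseudoscalarBilinear_mem_spectator (f g : Fin Nf) (x : TorusSite 4 (2 * S + 1))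
    (h1 : 1 ≤ ((Site.negReflect x) 0).val) (h2 : ((Site.negReflect x) 0).val ≤ S) :
    torusTheta (pseudoscalarBilinear f g x) ∈
      spectatorSubalgebra ℂ (negGens Nf (2 * S + 1) ∪ zeroGens Nf (2 * S + 1)) := by
  unfold pseudoscalarBilinear
  simp only [map_sum, map_smulₛₗ, torusTheta_mul, torusTheta_q, torusTheta_qbar]
  exact Subalgebra.sum_mem _ fun a _ => Subalgebra.sum_mem _ fun α _ => Subalgebra.sum_mem _ fun β _ =>
    Subalgebra.smul_mem _ (Subalgebra.mul_mem _
      (Subalgebra.sum_mem _ fun β' _ => Subalgebra.smul_mem _ (qbar_mem_spectator g _ a β' h1 h2) _)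
      (Subalgebra.sum_mem _ fun β' _ => Subalgebra.smul_mem _ (q_mem_spectator f _ a β' h1 h2) _)) _

/-- The torus time of `proj y` for `1 ≤ y₀ ≤ S` (`L = 2S+1`), as a pair of natural-number inequalities. -/
theorem one_le_val_proj_zero (y : Site 4) (hy1 : 1 ≤ y 0) (hyS : y 0 ≤ S) :
    1 ≤ ((Torus.proj (2 * S + 1) y) 0).val ∧ ((Torus.proj (2 * S + 1) y) 0).val ≤ S := by
  have hv := natCast_val_proj_zero (L := 2 * S + 1) y (by omega) (by push_cast; omega)
  constructor <;> omega

/-- The reflection of `proj (θ₀ y)` is `proj y`. -/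
theorem negReflect_proj_siteReflect {L : ℕ} (y : Site 4) :
    Site.negReflect (Torus.proj L (siteReflect y)) = Torus.proj L y := by
  rw [← proj_siteReflect, siteReflect_siteReflect]

end Mesons

/-! ### The registered stub -/

/-- **W2a-loc: locality and Grassmann support of the insertions (forward and reflected-backward).**  On the
torus of side `2S+1`, `1 ≤ S`: (1) the forward insertion at `y` with `1 ≤ y₀`, `y₀ + 1 ≤ S` depends on the
positive links only; (2) the reflected-backward insertion `insertion U.negReflect s (θ₀ y)` with `2 ≤ y₀ ≤ S`
depends on the positive links of `U` only; (3) for `1 ≤ y₀ ≤ S` both the forward insertion and the `Θ_T`-image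
of the reflected-backward one are spectators of `negGens ∪ zeroGens`. -/
theorem stub_insertion_local : ∀ {Nf : ℕ} (S : ℕ), 1 ≤ S → ∀ (s : QCDField Nf) (y : Site 4),
    (1 ≤ y 0 → y 0 + 1 ≤ S → ∀ U U' : GaugeConfig 4 (2 * S + 1) 𝔾, (∀ e ∈ posLinks S, U e = U' e) →
      insertion U s y = insertion U' s y) ∧
    (2 ≤ y 0 → y 0 ≤ S → ∀ U U' : GaugeConfig 4 (2 * S + 1) 𝔾, (∀ e ∈ posLinks S, U e = U' e) →
      insertion U.negReflect s (siteReflect y) = insertion U'.negReflect s (siteReflect y)) ∧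
    (1 ≤ y 0 → y 0 ≤ S → ∀ U : GaugeConfig 4 (2 * S + 1) 𝔾,
      insertion U s y ∈ spectatorSubalgebra ℂ (negGens Nf (2 * S + 1) ∪ zeroGens Nf (2 * S + 1)) ∧
      torusTheta (insertion U.negReflect s (siteReflect y)) ∈
        spectatorSubalgebra ℂ (negGens Nf (2 * S + 1) ∪ zeroGens Nf (2 * S + 1))) := by
  intro Nf S _ s y
  refine ⟨fun hy1 hyS U U' h => ?_, fun hy2 hyS U U' h => ?_, fun hy1 hyS U => ⟨?_, ?_⟩⟩
  · cases s with
    | glue => exact insertion_glue_congr hy1 hyS h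
    | pseudoRe f g => rfl
    | pseudoIm f g => rfl
  · cases s with
    | glue => exact insertion_glue_negReflect_congr hy2 hyS h
    | pseudoRe f g => rfl
    | pseudoIm f g => rfl
  · obtain ⟨h1, h2⟩ := one_le_val_proj_zero y hy1 hyS
    cases s with
    | glue => exact Subalgebra.algebraMap_mem _ _
    | pseudoRe f g =>
      exact Subalgebra.smul_mem _ (Subalgebra.add_mem _ (pseudoscalarBilinear_mem_spectator f g _ h1 h2)
        (pseudoscalarBilinear_mem_spectator g f _ h1 h2)) _
    | pseudoIm f g =>
      exact Subalgebra.smul_mem _ (Subalgebra.sub_mem _ (pseudoscalarBilinear_mem_spectator f g _ h1 h2)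
        (pseudoscalarBilinear_mem_spectator g f _ h1 h2)) _
  · have h12 := one_le_val_proj_zero y hy1 hyS
    rw [← negReflect_proj_siteReflect (L := 2 * S + 1)] at h12
    obtain ⟨h1, h2⟩ := h12
    cases s with
    | glue =>
      simp only [insertion, torusTheta_algebraMap]
      exact Subalgebra.algebraMap_mem _ _
    | pseudoRe f g =>
      simp only [insertion, map_smulₛₗ, map_add]
      exact Subalgebra.smul_mem _ (Subalgebra.add_mem _
        (torusTheta_pseudoscalarBilinear_mem_spectator f g _ h1 h2)
        (torusTheta_pseudoscalarBilinear_mem_spectator g f _ h1 h2)) _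
    | pseudoIm f g =>
      simp only [insertion, map_smulₛₗ, map_sub]
      exact Subalgebra.smul_mem _ (Subalgebra.sub_mem _
        (torusTheta_pseudoscalarBilinear_mem_spectator f g _ h1 h2)
        (torusTheta_pseudoscalarBilinear_mem_spectator g f _ h1 h2)) _

end Summit.QuantumFields.QCD.Cruxes.StableActionBridge.Sketch

end
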